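import Summits.BirchSwinnertonDyer.BirchSwinnertonDyer.Theorems.GenusKolyvaginAtTwoGenusPrimitiveSupplyAtTwoTwoTranspositionCount
import Summits.BirchSwinnertonDyer.BirchSwinnertonDyer.Theorems.GenusKolyvaginAtTwoGenusPrimitiveSupplyAtTwoRelaxedAtInfinityIndex
import Summits.BirchSwinnertonDyer.BirchSwinnertonDyer.Theorems.GenusKolyvaginAtTwoGenusPrimitiveSupplyAtTwoTwoTranspositionPlaneAlgebra
import Summits.BirchSwinnertonDyer.BirchSwinnertonDyer.Theorems.GenusKolyvaginAtTwoKramerParityOfFrame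
import HarnessLib

/-!
# Route `GenusKolyvaginAtTwo`, crux #2 `GenusPrimitiveSupplyAtTwo` (stmt-BirchSwinnertonDyer-22136):
# THE QUADRATIC `iff` OF T-2q `F1Sign2.TwoDoor.TwoTranspositionTwistLawAtTwo` IN FRAME CURRENCY — «`Sel₂(W^{(d)}) = 0` iff NO non-zero
# class of the ∞-relaxed Selmer group of `W` vanishes at both door primes», by the POONEN–RAINS quadratic form at the three `T`-places

Width seat `bsd-line-gk2-p4` g14 (cell `bsd-f1-sign2`), sequel of `…TwoTranspositionCount` (gk2-p4 g13: the COUNTING half `#Sel₂(W^{(d)}) ∈ {1,4}` /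
`{4,16}`), `…RelaxedAtInfinityIndex` (the dictionary `Sel^{rel ∞}_2(W) = H¹_{kummerRelaxed {∞}}`) and `…TwoTranspositionPlaneAlgebra` (the `𝔽₂`-algebra of a
hyperbolic plane with two transversal isotropic lines). THEOREMS ONLY; helper `--supports stmt-BirchSwinnertonDyer-22136`; no item is closed; BSD is not
proved by any of this.

WHAT. T-2q (a), second clause, typed: `twistSelmerTwoCard W d = 1 ↔ selmerGroupRelaxedAtInfinityAtTwo W ⊓ twistCondAbove W χ q₀ ⊓ twistCondAbove W χ q₁ = ⊥`.
For a class `c` of the ∞-relaxed group the twisted condition above a door prime `q_i` is — by the transversality of the two Kummer lines at a ramified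
transposition prime — the STRICT condition `loc_{q_i} c = 0`; this file proves the statement in that form (FRAME CURRENCY, the twisted conditions read
through the master frame `φ : W^{(d)}[2] ≅ W[2]` of gk2-p5, exactly as in the counting half):
**`twoTranspositionTwistLaw_iff_strict`** — under T-2q's binders and a door open at `q₀` or `q₁`,
`twistSelmerTwoCard W d = 1 ↔ H¹_{kummerRelaxed {∞}} ⊓ ker loc_{v₀} ⊓ ker loc_{v₁} = ⊥` (`v_i` the place of `q_i`; `H¹_{kummerRelaxed {∞}} = selmerGroupRelaxedAtInfinityAtTwo W`
by `selmerGroupRelaxedAtInfinityAtTwo_eq_kummerRelaxed`, p668051 — the statement is kept inside ONE presentation of `H¹(ℚ, E[2])` to spare the kernel the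
instance transport).
What is NOT bridged here: `c ∈ twistCondAbove W χ q_i ↔ loc_{v_i} c = 0` for `c ∈ Sel^{rel ∞}_2(W)` — the `PrimeTwist` (Mazur–Rubin 2007 `A_χ`) ↔
twist-MODEL dictionary at one ramified place; with it the typed T-2q is a theorem.

PROOF (Poonen–Rains). `q_v = can_v ∘ prClass` (the lead's theta/Heisenberg construction) is a `ℤ/2`-valued function on `H¹(ℚ_v, E[2])` with (Q1) polar form
`inv_v(· ∪ₑ ·)`, (Q2) `q_v(𝓚_v) = 0`, (Q4) `q_v(𝓐_v) = 0` for the framed twisted condition, (Q3) reciprocity `Σ_v q_v(loc_v c) = 0`; `𝓚_v` is its own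
annihilator (local Tate duality, Poitou–Tate inputs discharged). At `v ∈ T = {∞, v₀, v₁}` both lines have order `2` and meet trivially, so the plane algebra
applies. (⟹) `c` relaxed at `∞`, strict at `v₀, v₁`: reciprocity gives `q_∞(c_∞) = 0`, so `c_∞ ∈ 𝓚_∞` (then `c ∈ Sel₂(W) = {0, c_door}` with
`loc c_door ≠ 0` at the open door, so `c = 0`) or `c_∞ ∈ 𝓐_∞` (then `c ∈ Sel_𝓐 ≅ Sel₂(W^{(d)}) = 0`). (⟸) if `#Sel₂(W^{(d)}) = 4` then
`(loc_{v₀}, loc_{v₁}) : Sel_𝓐 → 𝓐_{v₀} × 𝓐_{v₁}` is injective (its kernel is the strict group, `= 0`) hence bijective (`4 = 2·2`); an `h` with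
`loc h = (a₀, 0)` (resp. `(0, a₁)`) pairs to `0` with `c_door` by bilinear reciprocity (`loc_∞ c_door = 0` as `E(ℚ) ⊂ E⁰(ℝ)`), contradicting the
non-degeneracy across the transversal lines at the open door.

References: [PoonenRains2012] Cor. 4.6, Prop. 4.8/4.10/4.11, Thm. 4.14; [KlagsbrunMazurRubin2013] Def. 3.2, Lemma 5.2; [MazurRubin2010] Def. 3.1,
Lemma 3.2, Prop. 3.3 (method), Lemma 2.11; [Kramer1981] Prop. 3, Prop. 6.
-/

set_option linter.dupNamespace false -- tree convention: `Summit.BirchSwinnertonDyer.BirchSwinnertonDyer.Theorems` (summit = sub-problem)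
set_option autoImplicit false

noncomputable section

open scoped Classical ContRepresentation

namespace Summit.BirchSwinnertonDyer.BirchSwinnertonDyer.Theorems.GenusKolyTransp

open WeierstrassCurve Field NumberField IsDedekindDomain Function
open Literature.NumberTheory.EllipticCurves Literature.NumberTheory.GaloisRepresentations
open Literature.NumberTheory.EllipticCurves.ThetaLevelTwo (prClass)
open Literature.NumberTheory.GaloisRepresentations.IsNonarchimedeanLocalField
open Literature.NumberTheory.GaloisRepresentations.DiscreteGaloisModule (SelmerStructure)
open Literature.NumberTheory.GaloisCohomology
open Rat.HeightOneSpectrum (primesEquiv natGenerator)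
open Summit.BirchSwinnertonDyer.Rank1Residual.F1Sign2
open Summit.BirchSwinnertonDyer.Rank1Residual.F1Sign2.TranspositionDoor (MeetsNonNormAt)
open Summit.BirchSwinnertonDyer.Rank1Residual.F1Sign2.TwoDoor (TwoTranspAdmissible)
open Summit.BirchSwinnertonDyer.Rank1Residual.X11b
open Summit.BirchSwinnertonDyer.Rank1Residual.X11b.CongruentTransfer
open Summit.BirchSwinnertonDyer.Rank1Residual.X11b.FiniteDuality (annRight mem_annRight_iff)
open Summit.BirchSwinnertonDyer.Rank1Residual.X11b.Relaxation (invWeilPairing)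
open Summit.BirchSwinnertonDyer.Rank1Residual.X11b.KummerPT (kummerRelaxed kummerRelaxed_of_mem kummerRelaxed_of_not_mem)
open Summit.BirchSwinnertonDyer.BirchSwinnertonDyer.Theorems.GenusKolyTwistLocal
open Summit.BirchSwinnertonDyer.BirchSwinnertonDyer.Theorems.GenusKolyArch
open Summit.BirchSwinnertonDyer.BirchSwinnertonDyer.Theorems.GenusKolyTwistTamagawa
  (transport_twist_agree_inr_of_menu)
open Summit.BirchSwinnertonDyer.BirchSwinnertonDyer.Theorems.GenusKolyTwistingPrime (primesEquiv_eq)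
open Summit.BirchSwinnertonDyer.BirchSwinnertonDyer.Theorems.GenusKolyKramer
  (tateQuadraticForm_prClass_Q1 tateQuadraticForm_prClass_Q2 tateQuadraticForm_prClass_Q3 canonical_prClass_eq_zero_of_mem_map_of_frame
   annRight_invWeilPairing_kummerSelmerStructure_eq nsmul_galoisCohomology)
open Summit.BirchSwinnertonDyer.Rank1Residual.GaloisImage.EP (forall_localEulerPoincareCharacteristic_adicCompletion)

universe u

/-! ## §25 The quadratic `iff` of T-2q (a), frame currency -/

/-- **THE QUADRATIC `iff` OF T-2q (a), FRAME CURRENCY.** For every globally minimal elliptic `W/ℚ` with `Δ_W > 0`, `E(ℚ)[2] = 0`, rank `1`,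
`Ш(W)[2] = 0`, `E(ℚ) ⊂ E⁰(ℝ)`, every two-transposition-admissible `(d, q₀, q₁)` with places `v₀ ∋ q₀`, `v₁ ∋ q₁`, and a door open at `q₀` or `q₁`:
`#Sel₂(W^{(d)}) = 1` **iff** no non-zero class of the ∞-relaxed `2`-Selmer group of `W` vanishes at both `v₀` and `v₁`
(`H¹_{kummerRelaxed {∞}} ⊓ ker loc_{v₀} ⊓ ker loc_{v₁} = ⊥`, where `H¹_{kummerRelaxed {∞}} = selmerGroupRelaxedAtInfinityAtTwo W` is
`selmerGroupRelaxedAtInfinityAtTwo_eq_kummerRelaxed`). Poonen–Rains quadratic form at `T = {∞, v₀, v₁}` (module docstring).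
[cite: PoonenRains2012, Thm. 4.14 and Prop. 4.11] [cite: KlagsbrunMazurRubin2013, Lemma 5.2] [cite: MazurRubin2010, Lemma 3.2 and Prop. 3.3] -/
theorem twoTranspositionTwistLaw_iff_strict :
    ∀ (W : WeierstrassCurve ℚ) [W.IsElliptic] [W.IsGloballyMinimal], 0 < W.Δ → NoRationalTwoTorsion W →
      W.mordellWeilRank = 1 → ShaTwoTrivial W → ¬ MeetsEgg W →
      ∀ (d : ℤ) (q₀ q₁ : ℕ) [Fact q₀.Prime] [Fact q₁.Prime], TwoTranspAdmissible W d q₀ q₁ →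
        ∀ (v₀ v₁ : HeightOneSpectrum (𝓞 ℚ)), (q₀ : 𝓞 ℚ) ∈ v₀.asIdeal → (q₁ : 𝓞 ℚ) ∈ v₁.asIdeal →
        (MeetsNonNormAt W q₀ ∨ MeetsNonNormAt W q₁) →
        (twistSelmerTwoCard W d = 1 ↔
          (kummerRelaxed W 2 {(Sum.inl Rat.infinitePlace : Place ℚ)}).selmerGroup ⊓
              (galoisCohomology.localization (W.torsionGaloisModule ((2 : ℕ) : ℤ)) (Sum.inr v₀) 1).ker ⊓
              (galoisCohomology.localization (W.torsionGaloisModule ((2 : ℕ) : ℤ)) (Sum.inr v₁) 1).ker = ⊥) := by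
  intro W _ _ hΔ hT hrank hSha hegg d q₀ q₁ _ _ hadm v₀ v₁ hv₀ hv₁ hdoor
  haveI : Fact (Nat.Prime 2) := ⟨Nat.prime_two⟩
  have hcard14 := ((twoTranspositionTwistLaw_card W hΔ hT hrank hSha hegg d q₀ q₁ hadm).1 hdoor)
  have hd := hadm
  obtain ⟨hdneg, hsf, hd8, hq₀, hq₁, hne, hq₀d, hq₁d, hjac₀, hjac₁, hprimes, -⟩ := hadm
  have hv₀₁ : v₀ ≠ v₁ := by
    intro h
    apply hne
    rw [← primesEquiv_eq hq₀ hv₀, ← primesEquiv_eq hq₁ hv₁, h]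
  obtain ⟨hq₀2, hq₀Δ, h2v₀, hv₀W, hram₀, ht₀⟩ :=
    transposition_place_facts W hsf hd8 hq₀d ((hprimes q₀ hq₀ hq₀d).1 inferInstance) hjac₀ hv₀
  obtain ⟨hq₁2, hq₁Δ, h2v₁, hv₁W, hram₁, ht₁⟩ :=
    transposition_place_facts W hsf hd8 hq₁d ((hprimes q₁ hq₁ hq₁d).1 inferInstance) hjac₁ hv₁
  -- the twist and ONE framed identification with all local properties (as in the counting half)
  have hd0 : d ≠ 0 := hdneg.ne
  have hdQ : ((d : ℤ) : ℚ) ≠ 0 := by exact_mod_cast hd0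
  haveI := W.isElliptic_quadraticTwist hdQ
  set Wd : WeierstrassCurve ℚ := W.quadraticTwist ((d : ℤ) : ℚ) with hWd
  have hC : (1 : VariableChange ℚ) • W.quadraticTwist ((d : ℤ) : ℚ) = Wd := one_smul _ _
  obtain ⟨φ, ψ, hψφ, hφψ, hsplit, -, htrfin, htrinf, π, A, hπ, hA⟩ := exists_intertwining_master_frame W Wd hdQ hC
  let 𝓚 : SelmerStructure (W.torsionGaloisModule ((2 : ℕ) : ℤ)) := W.kummerSelmerStructure ((2 : ℕ) : ℤ)
  have h𝓚 : ∀ v, 𝓚 v = W.kummerSelmerStructure ((2 : ℕ) : ℤ) v := fun _ ↦ rfl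
  let 𝓐 : SelmerStructure (W.torsionGaloisModule ((2 : ℕ) : ℤ)) := fun v ↦
    (Wd.kummerSelmerStructure ((2 : ℕ) : ℤ) v).map (galoisCohomology.map (φ.restrictField (Place.Completion v)) 1)
  have h𝓐 : ∀ v, 𝓐 v = (Wd.kummerSelmerStructure ((2 : ℕ) : ℤ) v).map
      (galoisCohomology.map (φ.restrictField (Place.Completion v)) 1) := fun _ ↦ rfl
  -- the three `T`-places
  set w₀ : InfinitePlace ℚ := Rat.infinitePlace with hw₀def
  have hw₀ : w₀.IsReal := Rat.isReal_infinitePlace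
  have hΔ' : 0 < InfinitePlace.embedding_of_isReal hw₀ W.Δ := by rwa [embedding_of_isReal_rat_apply, Rat.cast_pos]
  have hΔd : 0 < Wd.Δ := by
    rw [hWd, quadraticTwist_Δ]
    exact mul_pos (by positivity) hΔ
  have hΔd' : 0 < InfinitePlace.embedding_of_isReal hw₀ Wd.Δ := by rwa [embedding_of_isReal_rat_apply, Rat.cast_pos]
  let S : Finset (Place ℚ) := {Sum.inl w₀, Sum.inr v₀, Sum.inr v₁}
  have hS₀ : (Sum.inl w₀ : Place ℚ) ∉ ({Sum.inr v₀, Sum.inr v₁} : Finset (Place ℚ)) := by simp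
  have hS₁ : (Sum.inr v₀ : Place ℚ) ∉ ({Sum.inr v₁} : Finset (Place ℚ)) := by simpa using hv₀₁
  have hmemS : ∀ v : Place ℚ, v ∈ S ↔ v = Sum.inl w₀ ∨ v = Sum.inr v₀ ∨ v = Sum.inr v₁ := fun v ↦ by
    simp only [S, Finset.mem_insert, Finset.mem_singleton]
  -- agreement off `S` from the menu
  have hagree : ∀ v ∉ S, 𝓐 v = 𝓚 v := by
    rintro (w | v) hv
    · exact absurd ((hmemS _).mpr (Or.inl (by rw [Subsingleton.elim w w₀]))) hv
    · have hv0 : v ≠ v₀ := fun h ↦ hv ((hmemS _).mpr (Or.inr (Or.inl (by rw [h]))))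
      have hv1 : v ≠ v₁ := fun h ↦ hv ((hmemS _).mpr (Or.inr (Or.inr (by rw [h]))))
      exact transport_twist_agree_inr_of_menu W φ ψ hφψ hsplit 𝓐 h𝓐 v
        (twoTranspAdmissible_place_menu W hd hv₀ hv₁ hC φ ψ hψφ hφψ v hv0 hv1)
  -- local counts and transversality at the three places
  have hKinl : Nat.card (𝓚 (Sum.inl w₀)) = 2 := natCard_kummerSelmerStructure_inl_eq_two_of_isReal W hw₀ hΔ'
  have hKinr : ∀ {v : HeightOneSpectrum (𝓞 ℚ)}, ((2 : ℕ) : 𝓞 ℚ) ∉ v.asIdeal →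
      Nat.card (nsmulAddMonoidHom 2 : (W.baseChange (v.adicCompletion ℚ)).toAffine.Point →+ _).ker = 2 →
      Nat.card (𝓚 (Sum.inr v)) = 2 := fun {v} h2v ht ↦ by
    rw [h𝓚, W.natCard_kummerSelmerStructure_inr v two_ne_zero, natCard_quotient_span_natCast_eq_one_of_not_mem v h2v, mul_one]
    exact ht
  have hAcard : ∀ v : Place ℚ, Nat.card (𝓐 v) = Nat.card (Wd.kummerSelmerStructure ((2 : ℕ) : ℤ) v) := fun v ↦ by
    rw [h𝓐]
    exact Nat.card_congr (AddSubgroup.equivMapOfInjective _ _ (map_restrictField_injective_of_comp_eq φ ψ hψφ v)).toEquiv.symm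
  have hAinl : Nat.card (𝓐 (Sum.inl w₀)) = 2 := by
    rw [hAcard]
    exact natCard_kummerSelmerStructure_inl_eq_two_of_isReal Wd hw₀ hΔd'
  have hAinr : ∀ {v : HeightOneSpectrum (𝓞 ℚ)}, ((2 : ℕ) : 𝓞 ℚ) ∉ v.asIdeal →
      Nat.card (nsmulAddMonoidHom 2 : (W.baseChange (v.adicCompletion ℚ)).toAffine.Point →+ _).ker = 2 →
      Nat.card (𝓐 (Sum.inr v)) = 2 := fun {v} h2v ht ↦ by
    rw [hAcard, Wd.natCard_kummerSelmerStructure_inr v two_ne_zero, natCard_quotient_span_natCast_eq_one_of_not_mem v h2v, mul_one,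
      @natCard_ker_nsmul_eq_of_intertwining ℚ _ _ W Wd _ _ 2 two_ne_zero φ ψ hψφ hφψ (v.adicCompletion ℚ) _
        (HeightOneSpectrum.instAlgebraAdicCompletion (𝓞 ℚ) ℚ v) (charZero_adicCompletion v)]
    exact ht
  have htrinl : 𝓐 (Sum.inl w₀) ⊓ 𝓚 (Sum.inl w₀) = ⊥ := by
    rw [h𝓐, h𝓚, kummerSelmerStructure_apply, kummerSelmerStructure_apply]
    exact htrinf w₀ hw₀ hΔ' (forall_sq_ne_completion_of_neg (by exact_mod_cast hdneg) w₀)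
  have htrinr : ∀ {v : HeightOneSpectrum (𝓞 ℚ)}, W.HasGoodReductionAt v → ((2 : ℕ) : 𝓞 ℚ) ∉ v.asIdeal →
      closureEmb (K := ℚ) (v.adicCompletion ℚ) (geomSqrt ((d : ℤ) : ℚ)) ∉ maxUnramified (v.adicCompletion ℚ) →
      𝓐 (Sum.inr v) ⊓ 𝓚 (Sum.inr v) = ⊥ := fun {v} hvW h2v hram ↦ by
    rw [h𝓐, h𝓚, kummerSelmerStructure_apply, kummerSelmerStructure_apply]
    exact htrfin v hvW h2v hram
  -- Selmer cardinalities
  have hSelA : Nat.card 𝓐.selmerGroup = Nat.card (Wd.selmerGroup ((2 : ℕ) : ℤ)) :=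
    natCard_selmerGroup_transport_kummer W Wd 2 φ ψ hψφ hφψ 𝓐 h𝓐
  have hSelW : Nat.card (W.selmerGroup ((2 : ℕ) : ℤ)) = 2 := by
    rw [Nat.cast_ofNat]
    exact selmerTwoCard_eq_two_of_rank_one W hT hrank hSha
  have hSelK' : Nat.card 𝓚.selmerGroup = Nat.card (W.selmerGroup ((2 : ℕ) : ℤ)) := by
    rw [selmerGroup_eq_selmerGroup_kummerSelmerStructure]
    rfl
  have hSelK : Nat.card 𝓚.selmerGroup = 2 := hSelK'.trans hSelW
  have hSelKeq : W.selmerGroup ((2 : ℕ) : ℤ) = 𝓚.selmerGroup := W.selmerGroup_eq_selmerGroup_kummerSelmerStructure _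
  have hmodel : Nat.card (Wd.selmerGroup ((2 : ℕ) : ℤ)) = twistSelmerTwoCard W d := by
    rw [Nat.cast_ofNat]
    exact GenusKolyTwin.natCard_selmerGroup_model_eq_twistSelmerTwoCard W hd0 Wd ⟨1, hC⟩
  haveI hfinK : Finite 𝓚.selmerGroup := Nat.finite_of_card_ne_zero (by rw [hSelK]; norm_num)
  haveI hfinWd : Finite (Wd.selmerGroup ((2 : ℕ) : ℤ)) := Wd.finite_selmerGroup_holds (by norm_num)
  haveI hfinA : Finite 𝓐.selmerGroup :=
    Nat.finite_of_card_ne_zero (by rw [hSelA]; exact (Nat.card_pos (α := Wd.selmerGroup ((2 : ℕ) : ℤ))).ne')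
  -- the door class `c₀ ∈ Sel₂(W)`, non-zero at the open door; `Sel₂(W) = {0, c₀}`; `loc_∞ Sel₂(W) = 0`
  obtain ⟨c₀, hc₀, hne₀⟩ : ∃ c ∈ 𝓚.selmerGroup,
      galoisCohomology.localization (W.torsionGaloisModule ((2 : ℕ) : ℤ)) (Sum.inr v₀) 1 c ≠ 0 ∨
      galoisCohomology.localization (W.torsionGaloisModule ((2 : ℕ) : ℤ)) (Sum.inr v₁) 1 c ≠ 0 := by
    rcases hdoor with h | h
    · obtain ⟨c, hc, hne⟩ := exists_mem_selmerGroup_localization_ne_zero_of_meetsNonNormAt W v₀ hv₀ hq₀2 hq₀Δ h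
      exact ⟨c, hc, Or.inl hne⟩
    · obtain ⟨c, hc, hne⟩ := exists_mem_selmerGroup_localization_ne_zero_of_meetsNonNormAt W v₁ hv₁ hq₁2 hq₁Δ h
      exact ⟨c, hc, Or.inr hne⟩
  have hc₀0 : c₀ ≠ 0 := by
    rintro rfl
    rcases hne₀ with h | h <;> exact h (map_zero _)
  obtain ⟨g₀, hg₀, hg₀0, hKel⟩ := exists_ne_zero_of_natCard_eq_two 𝓚.selmerGroup hSelK
  have hcg : c₀ = g₀ := (hKel c₀ hc₀).resolve_left hc₀0
  have hstrictinf := forall_mem_selmerGroup_localization_inl_eq_zero_of_not_meetsEgg W hΔ hT hSha hegg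
  -- the Poonen–Rains quadratic data at level `2`
  obtain ⟨e, hμ, hadd₁, hadd₂, halt, hnondeg, hgal⟩ := exists_weilPairing_holds W 2 le_rfl (by norm_num)
  have hperf := LocalInvariants.canonical_isPerfect (K := ℚ) (n := 2)
  have hreal := LocalInvariants.canonical_injectiveAtRealPlaces (K := ℚ) (n := 2)
  have hEP := forall_localEulerPoincareCharacteristic_adicCompletion ℚ
  obtain ⟨qf, hqf⟩ : ∃ qf : ∀ v : Place ℚ, galoisCohomology ((W.torsionGaloisModule ((2 : ℕ) : ℤ)).toLocal v) 1 → ZMod 2,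
      qf = fun (v : Place ℚ) (x : galoisCohomology ((W.torsionGaloisModule ((2 : ℕ) : ℤ)).toLocal v) 1) =>
        LocalInvariants.canonical ℚ 2 v (prClass W two_ne_zero (Place.Completion v)
          (show galoisCohomology ((W.torsionGaloisModule (2 : ℤ)).toLocal v) 1 from x)) := ⟨_, rfl⟩
  let bf := fun v : Place ℚ ↦ invWeilPairing W 2 e hμ hadd₁ hadd₂ hgal (LocalInvariants.canonical ℚ 2) v
  have hQ1 : ∀ (v : Place ℚ) (x y), qf v (x + y) = qf v x + qf v y + bf v x y := fun v x y ↦ by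
    rw [hqf]
    exact tateQuadraticForm_prClass_Q1 W two_ne_zero e hμ hadd₁ hadd₂ hgal halt hnondeg (LocalInvariants.canonical ℚ 2) v x y
  have hQ2 : ∀ (v : Place ℚ) (x), x ∈ 𝓚 v → qf v x = 0 := fun v x hx ↦ by
    rw [hqf]
    exact tateQuadraticForm_prClass_Q2 W two_ne_zero (LocalInvariants.canonical ℚ 2) v x hx
  have hQ4 : ∀ (v : Place ℚ) (x), x ∈ 𝓐 v → qf v x = 0 := fun v x hx ↦ by
    rw [hqf]
    exact canonical_prClass_eq_zero_of_mem_map_of_frame W Wd two_ne_zero φ π hπ A hA v x hx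
  have hQ3 : ∀ (c : galoisCohomology (W.torsionGaloisModule ((2 : ℕ) : ℤ)) 1) (S' : Finset (Place ℚ)),
      (∀ v ∉ S', qf v (galoisCohomology.localization (W.torsionGaloisModule ((2 : ℕ) : ℤ)) v 1 c) = 0) →
      ∑ v ∈ S', qf v (galoisCohomology.localization (W.torsionGaloisModule ((2 : ℕ) : ℤ)) v 1 c) = 0 := fun c S' hS' ↦ by
    rw [hqf] at hS' ⊢
    exact tateQuadraticForm_prClass_Q3 W two_ne_zero c S' hS'
  have hann : ∀ (v : Place ℚ) (y), (∀ x ∈ 𝓚 v, bf v x y = 0) → y ∈ 𝓚 v := fun v y hy ↦ by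
    have h := annRight_invWeilPairing_kummerSelmerStructure_eq W 2 e hμ hadd₁ hadd₂ hgal halt hnondeg (LocalInvariants.canonical ℚ 2)
      Nat.prime_two.isPrimePow hperf hEP hreal v
    rw [h𝓚, ← h]
    exact (mem_annRight_iff _ _ _).mpr hy
  have h2x : ∀ (v : Place ℚ) (x : galoisCohomology ((W.torsionGaloisModule ((2 : ℕ) : ℤ)).toLocal v) 1), x + x = 0 := fun v x ↦ by
    rw [← two_nsmul]
    exact galoisCohomology.nsmul_eq_zero_of_forall _ (fun T : geomTorsion W ((2 : ℕ) : ℤ) => AddSubgroup.torsionBy.nsmul T) x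

  -- the ∞-relaxed group read through the Kummer structure
  have hRel : ∀ c : galoisCohomology (W.torsionGaloisModule ((2 : ℕ) : ℤ)) 1,
      c ∈ (kummerRelaxed W 2 {(Sum.inl Rat.infinitePlace : Place ℚ)}).selmerGroup ↔
        ∀ v : HeightOneSpectrum (𝓞 ℚ),
          galoisCohomology.localization (W.torsionGaloisModule ((2 : ℕ) : ℤ)) (Sum.inr v) 1 c ∈ 𝓚 (Sum.inr v) := by
    intro c
    refine ((kummerRelaxed W 2 {(Sum.inl Rat.infinitePlace : Place ℚ)}).mem_selmerGroup_iff c).trans ⟨fun h v ↦ ?_, fun h v ↦ ?_⟩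
    · have h' := h (Sum.inr v)
      rwa [kummerRelaxed_of_not_mem W 2 _ (by simp)] at h'
    · rcases v with w | v
      · rw [kummerRelaxed_of_mem W 2 _ (by rw [Finset.mem_singleton, Subsingleton.elim w Rat.infinitePlace])]
        exact AddSubgroup.mem_top _
      · rw [kummerRelaxed_of_not_mem W 2 _ (by simp)]
        exact h v
  have hcv : ∀ v, galoisCohomology.localization (W.torsionGaloisModule ((2 : ℕ) : ℤ)) (v) 1 c₀ ∈ 𝓚 v := (𝓚.mem_selmerGroup_iff c₀).mp hc₀
  have hcinf : galoisCohomology.localization (W.torsionGaloisModule ((2 : ℕ) : ℤ)) (Sum.inl w₀) 1 c₀ = 0 := hstrictinf c₀ hc₀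
  constructor
  · -- (⟹): `Sel₂(W^{(d)}) = 0` ⟹ the strict part of the ∞-relaxed group is trivial
    intro h1
    have hAbot : ∀ c ∈ 𝓐.selmerGroup, c = 0 := by
      have hcardA : Nat.card 𝓐.selmerGroup = 1 := by rw [hSelA, hmodel, h1]
      intro c hc
      haveI := (Nat.card_eq_one_iff_unique.mp hcardA).1
      exact congrArg Subtype.val (Subsingleton.elim (⟨c, hc⟩ : 𝓐.selmerGroup) ⟨0, zero_mem _⟩)
    rw [eq_bot_iff]
    intro c hc
    have hcR := (AddSubgroup.mem_inf.mp (AddSubgroup.mem_inf.mp hc).1).1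
    have hc0 : galoisCohomology.localization (W.torsionGaloisModule ((2 : ℕ) : ℤ)) (Sum.inr v₀) 1 c = 0 := (AddMonoidHom.mem_ker).mp (AddSubgroup.mem_inf.mp (AddSubgroup.mem_inf.mp hc).1).2
    have hc1 : galoisCohomology.localization (W.torsionGaloisModule ((2 : ℕ) : ℤ)) (Sum.inr v₁) 1 c = 0 := (AddMonoidHom.mem_ker).mp (AddSubgroup.mem_inf.mp hc).2
    rw [AddSubgroup.mem_bot]
    have hcfin : ∀ v : HeightOneSpectrum (𝓞 ℚ), galoisCohomology.localization (W.torsionGaloisModule ((2 : ℕ) : ℤ)) (Sum.inr v) 1 c ∈ 𝓚 (Sum.inr v) := (hRel c).mp hcR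
    -- reciprocity: `q_∞(c_∞) = 0`
    have hoff : ∀ v ∉ S, qf v (galoisCohomology.localization (W.torsionGaloisModule ((2 : ℕ) : ℤ)) (v) 1 c) = 0 := by
      rintro (w | v) hv
      · exact absurd ((hmemS _).mpr (Or.inl (by rw [Subsingleton.elim w w₀]))) hv
      · exact hQ2 _ _ (hcfin v)
    have hsum := hQ3 c S hoff
    rw [Finset.sum_insert hS₀, Finset.sum_insert hS₁, Finset.sum_singleton, hc0, hc1,
      hQ2 _ _ (zero_mem _), hQ2 _ _ (zero_mem _), add_zero, add_zero] at hsum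
    -- the quadratic trichotomy at `∞`
    rcases mem_or_mem_of_isotropic (bf (Sum.inl w₀)) (qf (Sum.inl w₀)) (hQ1 _) (𝓚 (Sum.inl w₀)) (𝓐 (Sum.inl w₀))
        (hQ2 _) (hQ4 _) (hann _) htrinl hKinl hAinl (h2x _) hsum with hKinf | hAinf
    · -- `c ∈ Sel₂(W) = {0, c₀}`, but `c` vanishes at the open door
      have hcSel : c ∈ 𝓚.selmerGroup := by
        refine (𝓚.mem_selmerGroup_iff c).mpr ?_
        rintro (w | v)
        · rw [Subsingleton.elim w w₀]; exact hKinf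
        · exact hcfin v
      rcases hKel c hcSel with h | h
      · exact h
      · exfalso
        rw [← hcg] at h
        rw [h] at hc0 hc1
        rcases hne₀ with hne | hne
        · exact hne hc0
        · exact hne hc1
    · -- `c ∈ Sel_𝓐 ≅ Sel₂(W^{(d)}) = 0`
      refine hAbot c ((𝓐.mem_selmerGroup_iff c).mpr fun v ↦ ?_)
      by_cases hv : v ∈ S
      · rcases (hmemS v).mp hv with rfl | rfl | rfl
        · exact hAinf
        · rw [hc0]; exact zero_mem _
        · rw [hc1]; exact zero_mem _
      · rw [hagree v hv]
        rcases v with w | v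
        · exact absurd ((hmemS _).mpr (Or.inl (by rw [Subsingleton.elim w w₀]))) hv
        · exact hcfin v
  · -- (⟸): the strict part trivial ⟹ `#Sel₂(W^{(d)}) ≠ 4`
    intro hbot
    rcases hcard14 with h1 | h4
    · exact h1
    exfalso
    have hcardA : Nat.card 𝓐.selmerGroup = 4 := by rw [hSelA, hmodel, h4]
    have hAv : ∀ h ∈ 𝓐.selmerGroup, ∀ v, galoisCohomology.localization (W.torsionGaloisModule ((2 : ℕ) : ℤ)) (v) 1 h ∈ 𝓐 v := fun h hh ↦ (𝓐.mem_selmerGroup_iff h).mp hh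
    -- an `h ∈ Sel_𝓐` strict at both door places is `0`
    have hker : ∀ h ∈ 𝓐.selmerGroup,
        galoisCohomology.localization (W.torsionGaloisModule ((2 : ℕ) : ℤ)) (Sum.inr v₀) 1 h = 0 →
        galoisCohomology.localization (W.torsionGaloisModule ((2 : ℕ) : ℤ)) (Sum.inr v₁) 1 h = 0 → h = 0 := by
      intro h hh h0 h1
      have hR : h ∈ (kummerRelaxed W 2 {(Sum.inl Rat.infinitePlace : Place ℚ)}).selmerGroup := by
        refine (hRel h).mpr fun v ↦ ?_
        by_cases hvS : (Sum.inr v : Place ℚ) ∈ S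
        · rcases (hmemS _).mp hvS with hv | hv | hv
          · cases hv
          · rw [Sum.inr_injective hv, h0]; exact zero_mem _
          · rw [Sum.inr_injective hv, h1]; exact zero_mem _
        · rw [← hagree _ hvS]; exact hAv h hh (Sum.inr v)
      have hmem := hbot.le (AddSubgroup.mem_inf.mpr ⟨AddSubgroup.mem_inf.mpr ⟨hR, (AddMonoidHom.mem_ker).mpr h0⟩,
        (AddMonoidHom.mem_ker).mpr h1⟩)
      exact (AddSubgroup.mem_bot).mp hmem
    -- `(loc_{v₀}, loc_{v₁}) : Sel_𝓐 → 𝓐_{v₀} × 𝓐_{v₁}` is injective, hence bijective (`4 = 2·2`)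
    haveI : Finite (𝓐 (Sum.inr v₀)) := Nat.finite_of_card_ne_zero (by rw [hAinr h2v₀ ht₀]; norm_num)
    haveI : Finite (𝓐 (Sum.inr v₁)) := Nat.finite_of_card_ne_zero (by rw [hAinr h2v₁ ht₁]; norm_num)
    let L : 𝓐.selmerGroup → (𝓐 (Sum.inr v₀)) × (𝓐 (Sum.inr v₁)) := fun h ↦
      (⟨galoisCohomology.localization (W.torsionGaloisModule ((2 : ℕ) : ℤ)) (Sum.inr v₀) 1 h.1, hAv h.1 h.2 (Sum.inr v₀)⟩, ⟨galoisCohomology.localization (W.torsionGaloisModule ((2 : ℕ) : ℤ)) (Sum.inr v₁) 1 h.1, hAv h.1 h.2 (Sum.inr v₁)⟩)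
    have hL₀ : ∀ h, ((L h).1 : galoisCohomology ((W.torsionGaloisModule ((2 : ℕ) : ℤ)).toLocal (Sum.inr v₀)) 1) =
        galoisCohomology.localization (W.torsionGaloisModule ((2 : ℕ) : ℤ)) (Sum.inr v₀) 1 h.1 := fun _ ↦ rfl
    have hL₁ : ∀ h, ((L h).2 : galoisCohomology ((W.torsionGaloisModule ((2 : ℕ) : ℤ)).toLocal (Sum.inr v₁)) 1) =
        galoisCohomology.localization (W.torsionGaloisModule ((2 : ℕ) : ℤ)) (Sum.inr v₁) 1 h.1 := fun _ ↦ rfl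
    have hLinj : Function.Injective L := by
      intro x y hxy
      have e0 : galoisCohomology.localization (W.torsionGaloisModule ((2 : ℕ) : ℤ)) (Sum.inr v₀) 1 x.1 = galoisCohomology.localization (W.torsionGaloisModule ((2 : ℕ) : ℤ)) (Sum.inr v₀) 1 y.1 := by rw [← hL₀, ← hL₀, hxy]
      have e1 : galoisCohomology.localization (W.torsionGaloisModule ((2 : ℕ) : ℤ)) (Sum.inr v₁) 1 x.1 = galoisCohomology.localization (W.torsionGaloisModule ((2 : ℕ) : ℤ)) (Sum.inr v₁) 1 y.1 := by rw [← hL₁, ← hL₁, hxy]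
      have hsub := hker (x.1 - y.1) (sub_mem x.2 y.2) (by rw [map_sub, e0, sub_self]) (by rw [map_sub, e1, sub_self])
      exact Subtype.ext (sub_eq_zero.mp hsub)
    have hLbij : Function.Bijective L := hLinj.bijective_of_nat_card_le (by
      rw [Nat.card_prod, hAinr h2v₀ ht₀, hAinr h2v₁ ht₁, hcardA])
    -- bilinear reciprocity against the door class `c₀` (its `∞`-component vanishes: `E(ℚ) ⊂ E⁰(ℝ)`)
    have hrec : ∀ h ∈ 𝓐.selmerGroup,
        bf (Sum.inr v₀) (galoisCohomology.localization (W.torsionGaloisModule ((2 : ℕ) : ℤ)) (Sum.inr v₀) 1 h) (galoisCohomology.localization (W.torsionGaloisModule ((2 : ℕ) : ℤ)) (Sum.inr v₀) 1 c₀) + bf (Sum.inr v₁) (galoisCohomology.localization (W.torsionGaloisModule ((2 : ℕ) : ℤ)) (Sum.inr v₁) 1 h) (galoisCohomology.localization (W.torsionGaloisModule ((2 : ℕ) : ℤ)) (Sum.inr v₁) 1 c₀) = 0 := by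
      intro h hh
      have hKoff : ∀ v ∉ S, galoisCohomology.localization (W.torsionGaloisModule ((2 : ℕ) : ℤ)) (v) 1 h ∈ 𝓚 v := fun v hv ↦ by rw [← hagree v hv]; exact hAv h hh v
      have s1 := hQ3 h S (fun v hv ↦ hQ2 v _ (hKoff v hv))
      have s2 := hQ3 c₀ S (fun v hv ↦ hQ2 v _ (hcv v))
      have s3 := hQ3 (h + c₀) S (fun v hv ↦ by rw [map_add]; exact hQ2 v _ (add_mem (hKoff v hv) (hcv v)))
      simp only [map_add, hQ1] at s3
      rw [Finset.sum_insert hS₀, Finset.sum_insert hS₁, Finset.sum_singleton] at s1 s2 s3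
      have hq0 : qf (Sum.inl w₀) 0 = 0 := hQ2 _ _ (zero_mem _)
      rw [hcinf, map_zero, hq0] at s3
      rw [hcinf, hq0] at s2
      linear_combination s3 - s1 - s2
    -- the classes with local components `(a₀, 0)` and `(0, a₁)`
    obtain ⟨a₀, ha₀, ha₀0, -⟩ := exists_ne_zero_of_natCard_eq_two (𝓐 (Sum.inr v₀)) (hAinr h2v₀ ht₀)
    obtain ⟨a₁, ha₁, ha₁0, -⟩ := exists_ne_zero_of_natCard_eq_two (𝓐 (Sum.inr v₁)) (hAinr h2v₁ ht₁)
    have hsymm : ∀ (v : Place ℚ) (x y), bf v x y = bf v y x := fun v x y ↦ polar_symm (bf v) (qf v) (hQ1 v) x y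
    rcases hne₀ with hne | hne
    · obtain ⟨h, hLh⟩ := hLbij.2 (⟨a₀, ha₀⟩, ⟨0, zero_mem _⟩)
      have hh0 : galoisCohomology.localization (W.torsionGaloisModule ((2 : ℕ) : ℤ)) (Sum.inr v₀) 1 h.1 = a₀ := by rw [← hL₀, hLh]
      have hh1 : galoisCohomology.localization (W.torsionGaloisModule ((2 : ℕ) : ℤ)) (Sum.inr v₁) 1 h.1 = 0 := by rw [← hL₁, hLh]
      have hr := hrec h.1 h.2
      rw [hh0, hh1, map_zero, AddMonoidHom.zero_apply, add_zero, hsymm] at hr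
      exact pairing_ne_zero_of_transversal (bf (Sum.inr v₀)) (𝓚 (Sum.inr v₀)) (𝓐 (Sum.inr v₀)) (hann _)
        (htrinr hv₀W h2v₀ hram₀) (hKinr h2v₀ ht₀) (hcv _) hne ha₀ ha₀0 hr
    · obtain ⟨h, hLh⟩ := hLbij.2 (⟨0, zero_mem _⟩, ⟨a₁, ha₁⟩)
      have hh0 : galoisCohomology.localization (W.torsionGaloisModule ((2 : ℕ) : ℤ)) (Sum.inr v₀) 1 h.1 = 0 := by rw [← hL₀, hLh]
      have hh1 : galoisCohomology.localization (W.torsionGaloisModule ((2 : ℕ) : ℤ)) (Sum.inr v₁) 1 h.1 = a₁ := by rw [← hL₁, hLh]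
      have hr := hrec h.1 h.2
      rw [hh0, hh1, map_zero, AddMonoidHom.zero_apply, zero_add, hsymm] at hr
      exact pairing_ne_zero_of_transversal (bf (Sum.inr v₁)) (𝓚 (Sum.inr v₁)) (𝓐 (Sum.inr v₁)) (hann _)
        (htrinr hv₁W h2v₁ hram₁) (hKinr h2v₁ ht₁) (hcv _) hne ha₁ ha₁0 hr

/-- **The same `iff` with the cell's `selmerGroupRelaxedAtInfinityAtTwo W`** (`F1Sign2/TwistSelmerRelaxedAtInfinityAtTwo.lean`) in place of
`H¹_{kummerRelaxed {∞}}` — the two groups coincide (`selmerGroupRelaxedAtInfinityAtTwo_eq_kummerRelaxed`, p668051); this is T-2q (a)'s second clause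
with `twistCondAbove W χ q_i` replaced by `ker loc_{v_i}` (equal on the relaxed group once the `PrimeTwist` ↔ model dictionary at a ramified
transposition prime is in the tree). [cite: MazurRubin2010, Def. 3.1 and Lemma 3.2] [cite: PoonenRains2012, Thm. 4.14] -/
theorem twoTranspositionTwistLaw_iff_strict_relaxedAtInfinity
    (W : WeierstrassCurve ℚ) [W.IsElliptic] [W.IsGloballyMinimal] (hΔ : 0 < W.Δ) (hT : NoRationalTwoTorsion W)
    (hrank : W.mordellWeilRank = 1) (hSha : ShaTwoTrivial W) (hegg : ¬ MeetsEgg W)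
    (d : ℤ) (q₀ q₁ : ℕ) [Fact q₀.Prime] [Fact q₁.Prime] (hadm : TwoTranspAdmissible W d q₀ q₁)
    (v₀ v₁ : HeightOneSpectrum (𝓞 ℚ)) (hv₀ : (q₀ : 𝓞 ℚ) ∈ v₀.asIdeal) (hv₁ : (q₁ : 𝓞 ℚ) ∈ v₁.asIdeal)
    (hdoor : MeetsNonNormAt W q₀ ∨ MeetsNonNormAt W q₁) :
    twistSelmerTwoCard W d = 1 ↔
      selmerGroupRelaxedAtInfinityAtTwo W ⊓
          (galoisCohomology.localization (W.torsionGaloisModule ((2 : ℕ) : ℤ)) (Sum.inr v₀) 1).ker ⊓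
          (galoisCohomology.localization (W.torsionGaloisModule ((2 : ℕ) : ℤ)) (Sum.inr v₁) 1).ker = ⊥ := by
  rw [selmerGroupRelaxedAtInfinityAtTwo_eq_kummerRelaxed W]
  exact twoTranspositionTwistLaw_iff_strict W hΔ hT hrank hSha hegg d q₀ q₁ hadm v₀ v₁ hv₀ hv₁ hdoor

end Summit.BirchSwinnertonDyer.BirchSwinnertonDyer.Theorems.GenusKolyTransp

end
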